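import Mathlib
import HarnessLib
import Summits.HubbardSuperconductivity.HubbardSuperconductivity.Theorems.KLProgrammeC4aTubeJetPrelims
import Summits.HubbardSuperconductivity.HubbardSuperconductivity.Theorems.KLProgrammeC4aLevelChart

/-!
# Route `KLProgramme` — crux C4a (inductive tangential bound), sub-lemma (L2)-continuum ASSEMBLED: the TADPOLE-JET theorem
# in the co-moving chart — angular jets of a one-slice loop integral read on the Fermi curve are bounded by the slice's `L¹`
# mass times the INTEGRATED co-moving jets of the vertex (Leibniz against the chart weight), with `n`-free constants

Cell `gate-hubbard-kl`, lane hubbard-kl-c4a-1 (g2); helper for the engine-flow child `KLRegimeEngineV17F2`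
(stmt-HubbardSuperconductivity-20437), stub (C) `stub_twoLeg_curvature`, (A)-lemma `TwoLegCurveJetBound … (klFlowFrameU … n) n`
(memo HOME/hubbard-kl-c4a-1/C4A-PLAN.md §2c, §6 (L2), §9, §10).

THE OBJECT.  In the FS-adapted chart `Φ = levelPoint μ K` of the (tame) frame band (`e_K(Φ(ρ,ϑ)) = ρ`, …C4aInvariantDefs; jointly
`C^∞` on the tube `|ρ| < r`, …C4aLevelChart) a one-slice tadpole contribution to the scale-`n` two-leg increment, read at the
curve point of angle `θ` and at a fixed loop frequency, is
  `T(θ) = ∫_{(ρ,ϑ) ∈ (−r,r)×(0,2π]} f(ρ) · W(ρ,ϑ) · V_ρ(Φ(0,θ), Φ(ρ,ϑ)) dρ dϑ`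
with `f` the slice profile AS A FUNCTION OF THE LEVEL (complex: `χ-weights/(iq₀ − ρ)`; smooth, supported inside `(−r, r)`),
`W` the real chart weight (Jacobian `u·∂_ρu` × angular density; smooth on the tube, `2π`-periodic, angular jets `≤ G_i`) and
`V_ρ(k, q)` the (fat) vertex at loop level `ρ`.  Shifting the loop angle along with the external one (`setIntegral_tube_eq_coMoving`)
the slice profile never sees `θ` (exact softness, `profile_coMoving_const`), the weight is read at `ϑ + θ` and the vertex along
the CO-MOVING field: `θ ↦ W(ρ, ϑ+θ) • coMoving μ K V_ρ 0 ρ ϑ θ`.  Hence (Leibniz + differentiation under the integral):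

* `norm_iteratedDeriv_tadpole_le` (§2): if `‖∂ₜⁱ coMoving μ K V_ρ θ ρ (θ + ϑ)|_{t=0}‖ ≤ a_i(ρ, ϑ)` (pointwise dominators in
  (level, RELATIVE angle), integrable on the tube — the `L¹(dϑ)` form the Cooper configuration needs, memo §2c) then for `j ≤ N`
  `‖T⁽ʲ⁾(θ)‖ ≤ Σ_{i ≤ j} C(j,i)·G_i·∫_{tube} ‖f(ρ)‖·a_{j−i}(ρ,ϑ)`, uniformly in `θ`, and `T` is `C^∞` (`contDiff_tadpole`);
* `norm_iteratedDeriv_tadpole_le_of_coMovingJets` (§3): the SUP form — under `CoMovingJets A r μ K V_ρ` (…C4aInvariantDefs §3)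
  `‖T⁽ʲ⁾(θ)‖ ≤ (Σ_{i ≤ j} C(j,i)·G_i·A_{j−i}) · 2π · ∫_{(−r,r)} ‖f‖` — slice mass × `n`-free jet constants: no inverse power of the
  scale is ever paid for a tangential derivative away from the umklapp corners (the (L4) class is excluded by hypothesis).

Supporting layers (…C4aTubeJetPrelims): periodicity of the chart and the shift identity of co-moving jets; global smoothness of the
integrand from smoothness ON THE TUBE plus the support of `f`; the qualitative domination of every jet on the tube from compactness +
double periodicity; smoothness of tube integrals.  Here: §1 smoothness of the legs and of the co-moving reading, the Leibniz bound;
§2 smoothness / periodicity / support of the integrand and THE THEOREM; §3 the sup form.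

Pure analysis on the tree's objects; nothing is asserted about the Hubbard model (the frequency sum, the lattice-sum ↔ integral
aliasing and the model's vertex bounds are the consumer's layers).  References: FST II CPAM 51 (1998) 1133 Thm 3.5 (the change of
variables), FST III CPAM 52 (1999) 273 §3.6; Hörmander ALPDO I Thm 1.1.9 [folklore]; BGM 2006 §2.4 [cite: BenfattoGiulianiMastropietro2006].
-/

noncomputable section

namespace Summit.HubbardSuperconductivity.HubbardSuperconductivity.Theorems.C4a

set_option linter.dupNamespace false -- summit = problem name (single-conjunct summit), D-0017

open Real Set MeasureTheory Filter
open scoped ContDiff Topology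
open Literature.Analysis.Calculus
open Literature.MathematicalPhysics.QuantumLattice Literature.MathematicalPhysics.QuantumLattice.BandSectorCounting
open Summit.HubbardSuperconductivity.HubbardSuperconductivity.Theorems.DispersionFlow
open Summit.HubbardSuperconductivity.HubbardSuperconductivity.Theorems.KLRegimeSplit
open Summit.HubbardSuperconductivity.HubbardSuperconductivity.Theorems.PerturbedFermiCurve

/-! ## §1–§2 The tadpole-jet theorem (pointwise co-moving dominators, `L¹` form) -/

section Tadpole

variable {a b : ℝ} (B : BandBounds a b) {K : TrigPolyC4v} {A : ℝ}
  (hA : ∀ p : Momentum, ∀ j ≤ 2, ‖iteratedFDeriv ℝ j (frameShift K) p‖ ≤ A) (hADt : 2 * A < B.Dtmin)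
  {μ r : ℝ} (hr : 0 < r) (hlo : a < μ - r - A) (hhi : μ + r + A < b)
include B hA hADt hr hlo hhi

/-- The external leg `θ ↦ Φ(0, θ)` is `C^∞` (the level `0` is inside the tube). -/
theorem contDiff_levelPoint_zero : ContDiff ℝ ∞ (fun θ : ℝ => levelPoint μ K 0 θ) := by
  have h : ContDiffOn ℝ ∞ (fun p : ℝ × ℝ => levelPoint μ K p.1 p.2) ({ρ : ℝ | |ρ| < r} ×ˢ univ) :=
    contDiffOn_levelPoint B hA hADt hlo hhi
  have hmap : ∀ θ : ℝ, ((0 : ℝ), θ) ∈ ({ρ : ℝ | |ρ| < r} ×ˢ (univ : Set ℝ)) := fun θ =>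
    Set.mk_mem_prod (by simp [abs_zero, hr]) (mem_univ _)
  have := h.comp_contDiff (contDiff_const.prodMk contDiff_id) hmap
  simpa only [Function.comp_def, id_eq] using this

omit hr in
/-- A loop leg `t ↦ Φ(ρ, ϑ + t)` at a level inside the tube is `C^∞`. -/
theorem contDiff_levelPoint_shift {ρ : ℝ} (hρ : |ρ| < r) (ϑ : ℝ) :
    ContDiff ℝ ∞ (fun t : ℝ => levelPoint μ K ρ (ϑ + t)) := by
  have h : ContDiffOn ℝ ∞ (fun p : ℝ × ℝ => levelPoint μ K p.1 p.2) ({ρ : ℝ | |ρ| < r} ×ˢ univ) :=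
    contDiffOn_levelPoint B hA hADt hlo hhi
  have hmap : ∀ t : ℝ, ((ρ : ℝ), ϑ + t) ∈ ({ρ : ℝ | |ρ| < r} ×ˢ (univ : Set ℝ)) := fun t =>
    Set.mk_mem_prod hρ (mem_univ _)
  have := h.comp_contDiff (contDiff_const.prodMk (contDiff_const.add contDiff_id)) hmap
  exact this

/-- The co-moving reading of a jointly smooth level-indexed kernel is `C^∞` in the flow time, at any level inside the tube. -/
theorem contDiff_coMoving {V : ℝ → Momentum → Momentum → ℂ}
    (hV : ContDiff ℝ ∞ fun x : ℝ × Momentum × Momentum => V x.1 x.2.1 x.2.2) {ρ : ℝ} (hρ : |ρ| < r) (θ ϑ : ℝ) :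
    ContDiff ℝ ∞ (coMoving μ K (V ρ) θ ρ ϑ) := by
  have h1 : ContDiff ℝ ∞ (fun t : ℝ => levelPoint μ K 0 (θ + t)) :=
    (contDiff_levelPoint_zero B hA hADt hr hlo hhi).comp (contDiff_const.add contDiff_id)
  have h2 := contDiff_levelPoint_shift B hA hADt hlo hhi hρ ϑ
  have h3 : ContDiff ℝ ∞ (fun t : ℝ => ((ρ : ℝ), (levelPoint μ K 0 (θ + t), levelPoint μ K ρ (ϑ + t)))) :=
    contDiff_const.prodMk (h1.prodMk h2)
  have h4 := hV.comp h3
  exact h4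

/-- **Leibniz bound for the co-moving integrand at a level inside the tube.**  With the weight's angular jets `≤ G_i` and the
kernel's co-moving jets at base angles `(θ, ϑ + θ)` dominated by `a_i(ρ, ϑ)`:
`‖∂_θʲ [f(ρ) · W(ρ, ϑ+θ) • coMoving μ K V_ρ 0 ρ ϑ θ]‖ ≤ ‖f ρ‖ · Σ_{i ≤ j} C(j,i) G_i a_{j−i}(ρ, ϑ)`. -/
theorem norm_iteratedDeriv_tadpole_integrand_le (f : ℝ → ℂ)
    {W : ℝ × ℝ → ℝ} (hW : ContDiffOn ℝ ∞ W ({ρ : ℝ | |ρ| < r} ×ˢ univ))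
    {N : ℕ} {G : ℕ → ℝ} (hWjet : ∀ ρ, |ρ| < r → ∀ i ≤ N, ∀ s, ‖iteratedDeriv i (fun s => W (ρ, s)) s‖ ≤ G i)
    {V : ℝ → Momentum → Momentum → ℂ} (hV : ContDiff ℝ ∞ fun x : ℝ × Momentum × Momentum => V x.1 x.2.1 x.2.2)
    {aV : ℕ → ℝ × ℝ → ℝ}
    (hVjet : ∀ θ ρ ϑ, |ρ| < r → ∀ i ≤ N, ‖iteratedDeriv i (coMoving μ K (V ρ) θ ρ (ϑ + θ)) 0‖ ≤ aV i (ρ, ϑ))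
    {ρ : ℝ} (hρ : |ρ| < r) (ϑ : ℝ) {j : ℕ} (hj : j ≤ N) (θ : ℝ) :
    ‖iteratedDeriv j (fun θ : ℝ => f ρ * (W (ρ, ϑ + θ) • coMoving μ K (V ρ) 0 ρ ϑ θ)) θ‖ ≤
      ‖f ρ‖ * ∑ i ∈ Finset.range (j + 1), (j.choose i : ℝ) * G i * aV (j - i) (ρ, ϑ) := by
  -- smoothness of the two `θ`-dependent factors
  have hWθ : ContDiff ℝ ∞ (fun θ : ℝ => W (ρ, ϑ + θ)) := by
    have hmap : ∀ t : ℝ, ((ρ : ℝ), ϑ + t) ∈ ({ρ : ℝ | |ρ| < r} ×ˢ (univ : Set ℝ)) := fun t => ⟨hρ, mem_univ _⟩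
    exact hW.comp_contDiff (contDiff_const.prodMk (contDiff_const.add contDiff_id)) hmap
  have hCo : ContDiff ℝ ∞ (coMoving μ K (V ρ) 0 ρ ϑ) := contDiff_coMoving B hA hADt hr hlo hhi hV hρ 0 ϑ
  have hprod : ContDiff ℝ ∞ (fun θ : ℝ => W (ρ, ϑ + θ) • coMoving μ K (V ρ) 0 ρ ϑ θ) := hWθ.smul hCo
  -- pull the constant slice factor out
  rw [iteratedDeriv_const_mul (f ρ) (hprod.contDiffAt.of_le (by exact_mod_cast le_top)), norm_mul]
  refine mul_le_mul_of_nonneg_left ?_ (norm_nonneg _)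
  -- Leibniz
  have hjN : (j : ℕ∞ω) ≤ ∞ := by exact_mod_cast le_top
  have hL := norm_iteratedFDeriv_smul_le hWθ hCo θ (n := j) hjN
  rw [norm_iteratedFDeriv_eq_norm_iteratedDeriv] at hL
  refine hL.trans (Finset.sum_le_sum fun i hi => ?_)
  have hij : i ≤ j := Nat.lt_succ_iff.mp (Finset.mem_range.mp hi)
  -- the weight factor
  have h1 : ‖iteratedFDeriv ℝ i (fun θ : ℝ => W (ρ, ϑ + θ)) θ‖ ≤ G i := by
    rw [norm_iteratedFDeriv_eq_norm_iteratedDeriv]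
    have key := congrFun (iteratedDeriv_comp_const_add i (fun s : ℝ => W (ρ, s)) ϑ) θ
    rw [key]
    exact hWjet ρ hρ i (hij.trans hj) (ϑ + θ)
  -- the kernel factor, through the shift identity
  have h2 : ‖iteratedFDeriv ℝ (j - i) (coMoving μ K (V ρ) 0 ρ ϑ) θ‖ ≤ aV (j - i) (ρ, ϑ) := by
    rw [norm_iteratedFDeriv_eq_norm_iteratedDeriv, iteratedDeriv_coMoving_base_zero]
    exact hVjet θ ρ ϑ hρ (j - i) ((Nat.sub_le j i).trans hj)
  have hG : 0 ≤ G i := (norm_nonneg _).trans h1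
  have hC : (0 : ℝ) ≤ (j.choose i : ℝ) := Nat.cast_nonneg _
  calc (j.choose i : ℝ) * ‖iteratedFDeriv ℝ i (fun θ : ℝ => W (ρ, ϑ + θ)) θ‖ *
        ‖iteratedFDeriv ℝ (j - i) (coMoving μ K (V ρ) 0 ρ ϑ) θ‖
      ≤ (j.choose i : ℝ) * G i * aV (j - i) (ρ, ϑ) :=
        mul_le_mul (mul_le_mul_of_nonneg_left h1 hC) h2 (norm_nonneg _) (mul_nonneg hC hG)


/-- **The tadpole integrand is jointly `C^∞`**: smooth on the open tube from the chart, weight and kernel, and locally zero off it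
because the slice profile is supported inside `(−r, r)`. -/
theorem contDiff_tadpoleIntegrand {f : ℝ → ℂ} (hf : ContDiff ℝ ∞ f) (hfsupp : tsupport f ⊆ Ioo (-r) r)
    {W : ℝ × ℝ → ℝ} (hW : ContDiffOn ℝ ∞ W ({ρ : ℝ | |ρ| < r} ×ˢ univ))
    {V : ℝ → Momentum → Momentum → ℂ} (hV : ContDiff ℝ ∞ fun x : ℝ × Momentum × Momentum => V x.1 x.2.1 x.2.2)
    {Ψ : ℝ × (ℝ × ℝ) → ℂ}
    (hΨ : Ψ = fun p => f p.2.1 * (W p.2 • V p.2.1 (levelPoint μ K 0 p.1) (levelPoint μ K p.2.1 p.2.2))) :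
    ContDiff ℝ ∞ Ψ := by
  set U : Set (ℝ × (ℝ × ℝ)) := {p | |p.2.1| < r} with hU
  have hUo : IsOpen U := isOpen_lt (continuous_abs.comp (continuous_fst.comp continuous_snd)) continuous_const
  -- smooth on the tube
  have hΦ : ContDiffOn ℝ ∞ (fun p : ℝ × ℝ => levelPoint μ K p.1 p.2) ({ρ : ℝ | |ρ| < r} ×ˢ univ) :=
    contDiffOn_levelPoint B hA hADt hlo hhi
  have h0 : ContDiff ℝ ∞ (fun p : ℝ × (ℝ × ℝ) => levelPoint μ K 0 p.1) :=
    (contDiff_levelPoint_zero B hA hADt hr hlo hhi).comp contDiff_fst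
  have hmaps : Set.MapsTo (fun p : ℝ × (ℝ × ℝ) => p.2) U ({ρ : ℝ | |ρ| < r} ×ˢ univ) := fun p hp =>
    Set.mk_mem_prod hp (mem_univ _)
  have h1 : ContDiffOn ℝ ∞ (fun p : ℝ × (ℝ × ℝ) => levelPoint μ K p.2.1 p.2.2) U :=
    hΦ.comp contDiff_snd.contDiffOn hmaps
  have h2 : ContDiffOn ℝ ∞ (fun p : ℝ × (ℝ × ℝ) => W p.2) U := hW.comp contDiff_snd.contDiffOn hmaps
  have h3 : ContDiffOn ℝ ∞ (fun p : ℝ × (ℝ × ℝ) => V p.2.1 (levelPoint μ K 0 p.1) (levelPoint μ K p.2.1 p.2.2)) U := by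
    have hg : ContDiffOn ℝ ∞
        (fun p : ℝ × (ℝ × ℝ) => ((p.2.1 : ℝ), (levelPoint μ K 0 p.1, levelPoint μ K p.2.1 p.2.2))) U :=
      (contDiff_fst.comp contDiff_snd).contDiffOn.prodMk (h0.contDiffOn.prodMk h1)
    exact hV.comp_contDiffOn hg
  have hf' : ContDiff ℝ ∞ (fun p : ℝ × (ℝ × ℝ) => f p.2.1) := hf.comp (contDiff_fst.comp contDiff_snd)
  have hon : ContDiffOn ℝ ∞ Ψ U := by
    rw [hΨ]
    exact hf'.contDiffOn.mul (h2.smul h3)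
  -- locally zero off the tube
  have hoff : ∀ p ∉ U, Ψ =ᶠ[𝓝 p] 0 := by
    intro p hp
    have hρ : p.2.1 ∉ tsupport f := fun h => hp (by
      have h' := hfsupp h
      show |p.2.1| < r
      exact abs_lt.2 ⟨h'.1, h'.2⟩)
    have hev : f =ᶠ[𝓝 p.2.1] 0 := notMem_tsupport_iff_eventuallyEq.mp hρ
    have hcont : ContinuousAt (fun q : ℝ × (ℝ × ℝ) => q.2.1) p := (continuous_fst.comp continuous_snd).continuousAt
    have hev' : ∀ᶠ q in 𝓝 p, f q.2.1 = 0 := hcont.eventually hev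
    filter_upwards [hev'] with q hq
    simp only [hΨ, hq, zero_mul, Pi.zero_apply]
  exact contDiff_of_contDiffOn_of_eventuallyEq_zero hUo hon hoff

omit B hA hADt hr hlo hhi in
/-- The tadpole integrand is `2π`-periodic in the loop angle. -/
theorem tadpoleIntegrand_periodic_loop {f : ℝ → ℂ} {W : ℝ × ℝ → ℝ}
    (hWper : ∀ ρ, Function.Periodic (fun ϑ => W (ρ, ϑ)) (2 * π)) {V : ℝ → Momentum → Momentum → ℂ}
    {Ψ : ℝ × (ℝ × ℝ) → ℂ}
    (hΨ : Ψ = fun p => f p.2.1 * (W p.2 • V p.2.1 (levelPoint μ K 0 p.1) (levelPoint μ K p.2.1 p.2.2))) (θ ρ : ℝ) :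
    Function.Periodic (fun ϑ => Ψ (θ, (ρ, ϑ))) (2 * π) := by
  intro ϑ
  have h1 : W (ρ, ϑ + 2 * π) = W (ρ, ϑ) := hWper ρ ϑ
  have h2 := levelPoint_periodic μ K ρ ϑ
  simp only [hΨ, h1, h2]

omit B hA hADt hr hlo hhi in
/-- The tadpole integrand is `2π`-periodic in the external angle. -/
theorem tadpoleIntegrand_periodic_ext {f : ℝ → ℂ} {W : ℝ × ℝ → ℝ} {V : ℝ → Momentum → Momentum → ℂ}
    {Ψ : ℝ × (ℝ × ℝ) → ℂ}
    (hΨ : Ψ = fun p => f p.2.1 * (W p.2 • V p.2.1 (levelPoint μ K 0 p.1) (levelPoint μ K p.2.1 p.2.2))) (a : ℝ × ℝ) :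
    Function.Periodic (fun θ => Ψ (θ, a)) (2 * π) := by
  intro θ
  have h := levelPoint_periodic μ K 0 θ
  simp only [hΨ, h]

omit B hA hADt hr hlo hhi in
/-- The tadpole integrand vanishes off the tube `|ρ| < r` (the slice profile is supported inside it). -/
theorem tadpoleIntegrand_eq_zero_of_le {f : ℝ → ℂ} (hfsupp : tsupport f ⊆ Ioo (-r) r) {W : ℝ × ℝ → ℝ}
    {V : ℝ → Momentum → Momentum → ℂ} {Ψ : ℝ × (ℝ × ℝ) → ℂ}
    (hΨ : Ψ = fun p => f p.2.1 * (W p.2 • V p.2.1 (levelPoint μ K 0 p.1) (levelPoint μ K p.2.1 p.2.2)))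
    (θ ρ ϑ : ℝ) (hρ : r ≤ |ρ|) : Ψ (θ, (ρ, ϑ)) = 0 := by
  have hρ' : ρ ∉ tsupport f := fun h => by
    have h' := hfsupp h
    have : |ρ| < r := abs_lt.2 ⟨h'.1, h'.2⟩
    linarith
  have hf0 : f ρ = 0 := image_eq_zero_of_notMem_tsupport hρ'
  simp only [hΨ, hf0, zero_mul]

/-- **THE TADPOLE-JET THEOREM (pointwise co-moving dominators).**  Tube `|ρ| < r` of a tame frame band (`B, hA, hADt, hlo, hhi`,
`0 < r`); slice profile `f` (`C^∞`, `tsupport f ⊆ (−r, r)`); chart weight `W` (`C^∞` on the tube, `2π`-periodic, angular jets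
`‖∂_ϑⁱ W(ρ, ·)‖ ≤ G i` for `i ≤ N`); level-indexed kernel `V` (jointly `C^∞`) whose co-moving jets at base angles `(θ, ϑ + θ)` — loop
leg at RELATIVE angle `ϑ` to the external leg — obey `‖∂ₜⁱ coMoving μ K V_ρ θ ρ (ϑ + θ)|₀‖ ≤ a_i(ρ, ϑ)` uniformly in `θ`, with
`a_i` integrable on the tube.  Then for `j ≤ N` and every `θ`:
`‖∂_θʲ ∫_{(−r,r)×(0,2π]} f(ρ)·W(ρ,ϑ)•V_ρ(Φ(0,θ),Φ(ρ,ϑ))‖ ≤ Σ_{i ≤ j} C(j,i)·G_i·∫_{tube} ‖f(ρ)‖·a_{j−i}(ρ,ϑ)`.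
No inverse power of the slice scale appears: the profile is never differentiated (exact softness), the weight and the vertex are
differentiated along the co-moving field only. -/
theorem norm_iteratedDeriv_tadpole_le {f : ℝ → ℂ} (hf : ContDiff ℝ ∞ f) (hfsupp : tsupport f ⊆ Ioo (-r) r)
    {W : ℝ × ℝ → ℝ} (hW : ContDiffOn ℝ ∞ W ({ρ : ℝ | |ρ| < r} ×ˢ univ))
    (hWper : ∀ ρ, Function.Periodic (fun ϑ => W (ρ, ϑ)) (2 * π))
    {N : ℕ} {G : ℕ → ℝ} (hWjet : ∀ ρ, |ρ| < r → ∀ i ≤ N, ∀ s, ‖iteratedDeriv i (fun s => W (ρ, s)) s‖ ≤ G i)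
    {V : ℝ → Momentum → Momentum → ℂ} (hV : ContDiff ℝ ∞ fun x : ℝ × Momentum × Momentum => V x.1 x.2.1 x.2.2)
    {aV : ℕ → ℝ × ℝ → ℝ} (haV : ∀ i ≤ N, IntegrableOn (aV i) (Ioo (-r) r ×ˢ Ioc 0 (2 * π)))
    (hVjet : ∀ θ ρ ϑ, |ρ| < r → ∀ i ≤ N, ‖iteratedDeriv i (coMoving μ K (V ρ) θ ρ (ϑ + θ)) 0‖ ≤ aV i (ρ, ϑ))
    {Ψ : ℝ × (ℝ × ℝ) → ℂ}
    (hΨ : Ψ = fun p => f p.2.1 * (W p.2 • V p.2.1 (levelPoint μ K 0 p.1) (levelPoint μ K p.2.1 p.2.2)))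
    {j : ℕ} (hj : j ≤ N) (θ : ℝ) :
    ‖iteratedDeriv j (fun θ : ℝ => ∫ a in Ioo (-r) r ×ˢ Ioc 0 (2 * π), Ψ (θ, a)) θ‖ ≤
      ∑ i ∈ Finset.range (j + 1), (j.choose i : ℝ) * G i *
        ∫ a in Ioo (-r) r ×ˢ Ioc 0 (2 * π), ‖f a.1‖ * aV (j - i) a := by
  set S : Set (ℝ × ℝ) := Ioo (-r) r ×ˢ Ioc 0 (2 * π) with hS
  have hΨs : ContDiff ℝ ∞ Ψ := contDiff_tadpoleIntegrand B hA hADt hr hlo hhi hf hfsupp hW hV hΨ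
  have hperϑ := tadpoleIntegrand_periodic_loop (μ := μ) (K := K) hWper hΨ
  have hperθ := tadpoleIntegrand_periodic_ext (μ := μ) (K := K) hΨ
  have hzero := tadpoleIntegrand_eq_zero_of_le (μ := μ) (K := K) hfsupp hΨ
  -- finite measure of the tube (for the constant dominators)
  have hSfin : volume S ≠ ⊤ :=
    ((Metric.isBounded_Ioo (-r) r).prod (Metric.isBounded_Ioc 0 (2 * π))).measure_lt_top.ne
  have hdom : ∀ m : ℕ, ∃ g : ℝ × ℝ → ℝ, IntegrableOn g S ∧
      ∀ a θ, ‖iteratedDeriv m (fun θ : ℝ => Ψ (θ, (a.1, a.2 + θ))) θ‖ ≤ g a := by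
    intro m
    obtain ⟨C, -, hC⟩ := exists_const_dom_tube hΨs two_pi_pos hperθ hperϑ hzero m
    exact ⟨fun _ => C, integrableOn_const hSfin, hC⟩
  -- a bound on the slice profile
  have hfcpt : HasCompactSupport f :=
    IsCompact.of_isClosed_subset isCompact_Icc (isClosed_tsupport f) (hfsupp.trans Ioo_subset_Icc_self)
  obtain ⟨Cf, hCf⟩ := hf.continuous.bounded_above_of_compact_support hfcpt
  -- the quantitative dominator of order j
  set g : ℝ × ℝ → ℝ := fun a => ‖f a.1‖ * ∑ i ∈ Finset.range (j + 1), (j.choose i : ℝ) * G i * aV (j - i) a with hg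
  have hsumInt : IntegrableOn (fun a => ∑ i ∈ Finset.range (j + 1), (j.choose i : ℝ) * G i * aV (j - i) a) S := by
    refine integrable_finsetSum _ fun i hi => ?_
    exact (haV (j - i) ((Nat.sub_le j i).trans hj)).const_mul _
  have hfmeas : AEStronglyMeasurable (fun a : ℝ × ℝ => ‖f a.1‖) (volume.restrict S) :=
    (continuous_norm.comp (hf.continuous.comp continuous_fst)).aestronglyMeasurable
  have hfbd : ∀ᵐ a ∂(volume.restrict S), ‖(fun a : ℝ × ℝ => ‖f a.1‖) a‖ ≤ Cf :=
    Eventually.of_forall fun a => by simp only [norm_norm]; exact hCf a.1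
  have hgInt : IntegrableOn g S := hsumInt.bdd_mul hfmeas hfbd
  -- the pointwise bound
  have hb : ∀ a : ℝ × ℝ, ‖iteratedDeriv j (fun θ : ℝ => Ψ (θ, (a.1, a.2 + θ))) θ‖ ≤ g a := by
    intro a
    by_cases ha : |a.1| < r
    · have key := norm_iteratedDeriv_tadpole_integrand_le B hA hADt hr hlo hhi f hW hWjet hV hVjet ha a.2 hj θ
      have hfun : (fun θ : ℝ => Ψ (θ, (a.1, a.2 + θ))) =
          fun θ => f a.1 * (W (a.1, a.2 + θ) • coMoving μ K (V a.1) 0 a.1 a.2 θ) := by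
        funext θ'
        simp only [hΨ, coMoving, zero_add]
      rw [hfun]
      exact key
    · have hz : (fun θ : ℝ => Ψ (θ, (a.1, a.2 + θ))) = fun _ => (0 : ℂ) :=
        funext fun θ' => hzero θ' a.1 _ (not_lt.mp ha)
      have hρ' : a.1 ∉ tsupport f := fun h => ha (by have h' := hfsupp h; exact abs_lt.2 ⟨h'.1, h'.2⟩)
      have hf0 : f a.1 = 0 := image_eq_zero_of_notMem_tsupport hρ'
      rw [hz, iteratedDeriv_const]
      simp [hg, hf0]
  have hmain := norm_iteratedDeriv_tube_integral_le hΨs two_pi_pos hperϑ hdom (n := j) (θ := θ) hgInt hb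
  refine hmain.trans (le_of_eq ?_)
  -- ∫ g = Σ_i C(j,i) G_i ∫ ‖f‖ a_{j-i}
  have hgeq : g = fun a => ∑ i ∈ Finset.range (j + 1), ((j.choose i : ℝ) * G i) * (‖f a.1‖ * aV (j - i) a) := by
    funext a
    simp only [hg]
    rw [Finset.mul_sum]
    exact Finset.sum_congr rfl fun i _ => by ring
  have hterm : ∀ i ∈ Finset.range (j + 1),
      Integrable (fun a : ℝ × ℝ => ((j.choose i : ℝ) * G i) * (‖f a.1‖ * aV (j - i) a)) (volume.restrict S) := by
    intro i hi
    have hij : j - i ≤ N := (Nat.sub_le j i).trans hj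
    exact ((haV (j - i) hij).bdd_mul hfmeas hfbd).const_mul _
  rw [hgeq, integral_finsetSum _ hterm]
  refine Finset.sum_congr rfl fun i _ => ?_
  rw [integral_const_mul]

/-- **The tadpole is `C^∞` in the external angle** (same hypotheses, no jet bounds needed). -/
theorem contDiff_tadpole {f : ℝ → ℂ} (hf : ContDiff ℝ ∞ f) (hfsupp : tsupport f ⊆ Ioo (-r) r)
    {W : ℝ × ℝ → ℝ} (hW : ContDiffOn ℝ ∞ W ({ρ : ℝ | |ρ| < r} ×ˢ univ))
    (hWper : ∀ ρ, Function.Periodic (fun ϑ => W (ρ, ϑ)) (2 * π))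
    {V : ℝ → Momentum → Momentum → ℂ} (hV : ContDiff ℝ ∞ fun x : ℝ × Momentum × Momentum => V x.1 x.2.1 x.2.2)
    {Ψ : ℝ × (ℝ × ℝ) → ℂ}
    (hΨ : Ψ = fun p => f p.2.1 * (W p.2 • V p.2.1 (levelPoint μ K 0 p.1) (levelPoint μ K p.2.1 p.2.2))) :
    ContDiff ℝ ∞ (fun θ : ℝ => ∫ a in Ioo (-r) r ×ˢ Ioc 0 (2 * π), Ψ (θ, a)) := by
  set S : Set (ℝ × ℝ) := Ioo (-r) r ×ˢ Ioc 0 (2 * π) with hS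
  have hΨs : ContDiff ℝ ∞ Ψ := contDiff_tadpoleIntegrand B hA hADt hr hlo hhi hf hfsupp hW hV hΨ
  have hperϑ := tadpoleIntegrand_periodic_loop (μ := μ) (K := K) hWper hΨ
  have hperθ := tadpoleIntegrand_periodic_ext (μ := μ) (K := K) hΨ
  have hzero := tadpoleIntegrand_eq_zero_of_le (μ := μ) (K := K) hfsupp hΨ
  have hSfin : volume S ≠ ⊤ :=
    ((Metric.isBounded_Ioo (-r) r).prod (Metric.isBounded_Ioc 0 (2 * π))).measure_lt_top.ne
  have hdom : ∀ m : ℕ, ∃ g : ℝ × ℝ → ℝ, IntegrableOn g S ∧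
      ∀ a θ, ‖iteratedDeriv m (fun θ : ℝ => Ψ (θ, (a.1, a.2 + θ))) θ‖ ≤ g a := by
    intro m
    obtain ⟨C, -, hC⟩ := exists_const_dom_tube hΨs two_pi_pos hperθ hperϑ hzero m
    exact ⟨fun _ => C, integrableOn_const hSfin, hC⟩
  exact contDiff_tube_integral hΨs two_pi_pos hperϑ hdom

end Tadpole

/-! ## §3 The SUP form: `CoMovingJets` constants × slice mass -/

/-- Fubini on the tube for a function of the level only: `∫_{(−r,r)×(0,T]} g(ρ) = T·∫_{(−r,r)} g`. -/
theorem setIntegral_tube_fst (g : ℝ → ℝ) (r : ℝ) {T : ℝ} (hT : 0 ≤ T) :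
    ∫ a in Ioo (-r) r ×ˢ Ioc 0 T, g a.1 = T * ∫ ρ in Ioo (-r) r, g ρ := by
  rw [Measure.volume_eq_prod]
  have h := setIntegral_prod_mul (μ := (volume : Measure ℝ)) (ν := (volume : Measure ℝ)) g (fun _ : ℝ => (1 : ℝ))
    (Ioo (-r) r) (Ioc 0 T)
  simp only [mul_one] at h
  rw [h, integral_const, smul_eq_mul, mul_one, Measure.real, Measure.restrict_apply MeasurableSet.univ, univ_inter,
    Real.volume_Ioc, sub_zero, ENNReal.toReal_ofReal hT, mul_comm]

section Sup

variable {a b : ℝ} (B : BandBounds a b) {K : TrigPolyC4v} {A : ℝ}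
  (hA : ∀ p : Momentum, ∀ j ≤ 2, ‖iteratedFDeriv ℝ j (frameShift K) p‖ ≤ A) (hADt : 2 * A < B.Dtmin)
  {μ r : ℝ} (hr : 0 < r) (hlo : a < μ - r - A) (hhi : μ + r + A < b)
include B hA hADt hr hlo hhi

/-- **THE TADPOLE-JET THEOREM, sup form.**  If every level-`ρ` kernel has BOUNDED CO-MOVING JETS on the tube, `CoMovingJets Av r μ K V_ρ`
(…C4aInvariantDefs §3: `C⁴` in the flow time, `‖∂ₜⁱ‖ ≤ Av i`, `i ≤ 4`, at all base angles), then for `j ≤ 4`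
`‖∂_θʲ ∫_{(−r,r)×(0,2π]} f(ρ)·W(ρ,ϑ)•V_ρ(Φ(0,θ),Φ(ρ,ϑ))‖ ≤ (Σ_{i ≤ j} C(j,i)·G_i·Av_{j−i}) · 2π · ∫_{(−r,r)} ‖f‖`:
jet constants of the weight and the vertex times the `L¹` MASS of the slice — with `n`-free `Av` (memo (J_n)) the only scale
dependence left is the slice mass, i.e. the VALUE-level size of the tadpole. -/
theorem norm_iteratedDeriv_tadpole_le_of_coMovingJets {f : ℝ → ℂ} (hf : ContDiff ℝ ∞ f) (hfsupp : tsupport f ⊆ Ioo (-r) r)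
    {W : ℝ × ℝ → ℝ} (hW : ContDiffOn ℝ ∞ W ({ρ : ℝ | |ρ| < r} ×ˢ univ))
    (hWper : ∀ ρ, Function.Periodic (fun ϑ => W (ρ, ϑ)) (2 * π))
    {G : ℕ → ℝ} (hWjet : ∀ ρ, |ρ| < r → ∀ i ≤ 4, ∀ s, ‖iteratedDeriv i (fun s => W (ρ, s)) s‖ ≤ G i)
    {V : ℝ → Momentum → Momentum → ℂ} (hV : ContDiff ℝ ∞ fun x : ℝ × Momentum × Momentum => V x.1 x.2.1 x.2.2)
    {Av : ℕ → ℝ} (hVJ : ∀ ρ, |ρ| < r → CoMovingJets Av r μ K (V ρ))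
    {Ψ : ℝ × (ℝ × ℝ) → ℂ}
    (hΨ : Ψ = fun p => f p.2.1 * (W p.2 • V p.2.1 (levelPoint μ K 0 p.1) (levelPoint μ K p.2.1 p.2.2)))
    {j : ℕ} (hj : j ≤ 4) (θ : ℝ) :
    ‖iteratedDeriv j (fun θ : ℝ => ∫ a in Ioo (-r) r ×ˢ Ioc 0 (2 * π), Ψ (θ, a)) θ‖ ≤
      (∑ i ∈ Finset.range (j + 1), (j.choose i : ℝ) * G i * Av (j - i)) * ((2 * π) * ∫ ρ in Ioo (-r) r, ‖f ρ‖) := by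
  set S : Set (ℝ × ℝ) := Ioo (-r) r ×ˢ Ioc 0 (2 * π) with hS
  have hSfin : volume S ≠ ⊤ :=
    ((Metric.isBounded_Ioo (-r) r).prod (Metric.isBounded_Ioc 0 (2 * π))).measure_lt_top.ne
  have haV : ∀ i ≤ 4, IntegrableOn ((fun i (_ : ℝ × ℝ) => Av i) i) S := fun i _ => integrableOn_const hSfin
  have hVjet : ∀ θ ρ ϑ, |ρ| < r → ∀ i ≤ 4,
      ‖iteratedDeriv i (coMoving μ K (V ρ) θ ρ (ϑ + θ)) 0‖ ≤ (fun i (_ : ℝ × ℝ) => Av i) i (ρ, ϑ) :=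
    fun θ ρ ϑ hρ i hi => ((hVJ ρ hρ) θ ρ (ϑ + θ) hρ.le).2 i hi
  have hmain := norm_iteratedDeriv_tadpole_le B hA hADt hr hlo hhi hf hfsupp hW hWper hWjet hV haV hVjet hΨ hj θ
  refine hmain.trans (le_of_eq ?_)
  rw [Finset.sum_mul]
  refine Finset.sum_congr rfl fun i _ => ?_
  show (j.choose i : ℝ) * G i * (∫ a in S, ‖f a.1‖ * Av (j - i)) = _
  rw [integral_mul_const, setIntegral_tube_fst (fun ρ => ‖f ρ‖) r two_pi_pos.le]
  ring

end Sup

end Summit.HubbardSuperconductivity.HubbardSuperconductivity.Theorems.C4a
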